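import Summits.BirchSwinnertonDyer.BirchSwinnertonDyer.Theses.ShaPrimaryTransfer
import Literature.NumberTheory.EllipticCurves.KubertTate916EisensteinTwist
import Literature.NumberTheory.EllipticCurves.CastellaGrossiLeeSkinner2022.PConverse
import Literature.NumberTheory.EllipticCurves.IwasawaLeadingTermProofs
import HarnessLib

/-!
# BirchSwinnertonDyer / ShaPrimaryTransfer — crux `FiniteShaComponentTransfer` (stmt-BirchSwinnertonDyer-22356):
# a RANK-0 Eisenstein-twist door `W₃ = [1, 389, −12, −74139, −35685119] ≅ E_{9/16}^{(-3)}` through the CLASS-WIDE reading (`r = 0` case)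

Helper file of prover seat `bsd-line-spt-p1` g22 (`--supports stmt-22356 --as helper`). THEOREMS ONLY; route-independent imports (no Theorems
module of the route cone is imported).  Instantiation of the class-wide Literature theorem `KubertTateEisensteinTwist.cgls_hypotheses_of_model`
(the same content as `ShaPrimaryTransferEisensteinTwistDoor.transfer_of_eisensteinTwistModel_of_thmE`) at `(m, n) = (9, 16)`: `E_{9/16} = [7, -144, -2304, 0, 0]`
(rank `1`, full box, Eisenstein-tame, `mn = 144`, `ω₂ = 0`), twist minimal model `W₃` (tree `KubertTate916EisensteinTwist`: rank `0`,
`t₅ = 0`, `a₅ = -1`, `corank_{ℤ₅} Sel_{5^∞} = 0`, all through the class-wide `cgls_hypotheses_of_model`).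

* `oneFiniteShaComponent_W₃` (unconditional, door `5`), `transfer_W₃` (T by name);
* `analyticRank_W₃_eq_zero_and_finite_sha_of_thmE`, **`transfer_W₃_of_thmE`** — modulo CGLS Thm. E + GZK: `L(W₃, 1) ≠ 0`, `Ш(W₃/ℚ)`
  finite, and T HOLDS AT `W₃`.

T itself is UNCHANGED (open at corank ≥ 2) and BSD is NOT proved by any of this.

## References

* [CastellaGrossiLeeSkinner2022] F. Castella, G. Grossi, J. Lee, C. Skinner, Invent. Math. 227 (2022), Theorem E.
* [Darmon2004] H. Darmon, CBMS 101, Thm. 3.22 (Gross–Zagier–Kolyvagin).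
* [SilvermanAEC2009] J. H. Silverman, *AEC*, 2nd ed., Thm. X.4.2, Exercise 10.16.
-/

-- D-0017: single-problem summit, so `Summit.BirchSwinnertonDyer.BirchSwinnertonDyer.…` repeats a namespace BY DESIGN.
set_option linter.dupNamespace false
set_option autoImplicit false

noncomputable section

open scoped Classical
open Literature.NumberTheory.EllipticCurves WeierstrassCurve
open Literature.NumberTheory.EllipticCurves.Rank1Residual
open Literature.NumberTheory.EllipticCurves.CastellaGrossiLeeSkinner2022
open Summit.BirchSwinnertonDyer.BirchSwinnertonDyer.Theses.ShaPrimaryTransfer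

namespace Summit.BirchSwinnertonDyer.BirchSwinnertonDyer.Theorems.ShaPrimaryTransferEisensteinTwistDoor916

/-- **O for `W₃` with witness `p₀ = 5`, unconditional** (`t₅(W₃) = corank Sel₅∞ − rank = 0 − 0`; tree `cgls_hypotheses_9_16`).
[cite: SilvermanAEC2009, Thm. X.4.2] -/
theorem oneFiniteShaComponent_W₃ :
    haveI := KubertTate916EisensteinTwist.isElliptic_model
    ∃ (p : ℕ) (_ : Fact p.Prime),
      (⟨((1 : ℤ) : ℚ), ((389 : ℤ) : ℚ), ((-12 : ℤ) : ℚ), ((-74139 : ℤ) : ℚ), ((-35685119 : ℤ) : ℚ)⟩ : WeierstrassCurve ℚ).shaCorank p = 0 := by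
  haveI := KubertTate916EisensteinTwist.isElliptic_model
  haveI := KubertTate916EisensteinTwist.isGloballyMinimal_model
  haveI : Fact (Nat.Prime 5) := ⟨Nat.prime_five⟩
  refine ⟨5, inferInstance, ?_⟩
  obtain ⟨-, -, -, hsel, hrk⟩ := KubertTate916EisensteinTwist.cgls_hypotheses_9_16
  have hG := (⟨((1 : ℤ) : ℚ), ((389 : ℤ) : ℚ), ((-12 : ℤ) : ℚ), ((-74139 : ℤ) : ℚ), ((-35685119 : ℤ) : ℚ)⟩ :
    WeierstrassCurve ℚ).selmerCorank_eq_mordellWeilRank_add_holds 5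
  omega

/-- **T BY NAME on `W₃`**: granting `FiniteShaComponentTransfer`, every `t_q(W₃) = 0`. T itself is NOT proved. [cite: SilvermanAEC2009, Thm. X.4.2] -/
theorem transfer_W₃ (hT : FiniteShaComponentTransfer) (q : ℕ) [Fact q.Prime] :
    haveI := KubertTate916EisensteinTwist.isElliptic_model
    (⟨((1 : ℤ) : ℚ), ((389 : ℤ) : ℚ), ((-12 : ℤ) : ℚ), ((-74139 : ℤ) : ℚ), ((-35685119 : ℤ) : ℚ)⟩ : WeierstrassCurve ℚ).shaCorank q = 0 := by
  haveI := KubertTate916EisensteinTwist.isElliptic_model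
  obtain ⟨p, hp, h0⟩ := oneFiniteShaComponent_W₃
  exact hT _ p q h0

/-- **`L(W₃, 1) ≠ 0` (`ord_{s=1} L(W₃, s) = 0 = rank W₃(ℚ)`) and `Ш(W₃/ℚ)` finite, modulo CGLS Thm. E (`r = 0`) + GZK**: the pair `(W₃, 5)` is a
non-anomalous Eisenstein pair of good reduction with `corank_{ℤ₅} Sel_{5^∞}(W₃/ℚ) = 0` (tree `cgls_hypotheses_9_16`, via the class-wide theorem).
[cite: CastellaGrossiLeeSkinner2022, Theorem E (r = 0)] [cite: Darmon2004, Thm. 3.22] -/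
theorem analyticRank_W₃_eq_zero_and_finite_sha_of_thmE
    (h0 : thmE_analyticRank_eq_zero_of_selmerCorank_eq_zero) (hGZK : rank_eq_analyticRank_of_analyticRank_le_one) :
    haveI := KubertTate916EisensteinTwist.isElliptic_model
    (⟨((1 : ℤ) : ℚ), ((389 : ℤ) : ℚ), ((-12 : ℤ) : ℚ), ((-74139 : ℤ) : ℚ), ((-35685119 : ℤ) : ℚ)⟩ : WeierstrassCurve ℚ).analyticRank = 0 ∧
      (⟨((1 : ℤ) : ℚ), ((389 : ℤ) : ℚ), ((-12 : ℤ) : ℚ), ((-74139 : ℤ) : ℚ), ((-35685119 : ℤ) : ℚ)⟩ : WeierstrassCurve ℚ).mordellWeilRank = 0 ∧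
      Finite (⟨((1 : ℤ) : ℚ), ((389 : ℤ) : ℚ), ((-12 : ℤ) : ℚ), ((-74139 : ℤ) : ℚ), ((-35685119 : ℤ) : ℚ)⟩ : WeierstrassCurve ℚ).sha := by
  haveI := KubertTate916EisensteinTwist.isElliptic_model
  haveI := KubertTate916EisensteinTwist.isGloballyMinimal_model
  haveI : Fact (Nat.Prime 5) := ⟨Nat.prime_five⟩
  obtain ⟨hgood, hred, hna, hsel, hrk⟩ := KubertTate916EisensteinTwist.cgls_hypotheses_9_16
  obtain ⟨ha, -, hfin⟩ := rank_eq_zero_and_finite_sha_of_thmE (p := 5) h0 hGZK (by norm_num) hgood hred hna hsel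
  exact ⟨ha, hrk, hfin⟩

/-- **T DISCHARGED AT `W₃` MODULO REFEREED PRINT** (CGLS Thm. E + GZK): every `t_q(W₃) = 0`. [cite: CastellaGrossiLeeSkinner2022, Theorem E]
[cite: Darmon2004, Thm. 3.22] -/
theorem transfer_W₃_of_thmE (h0 : thmE_analyticRank_eq_zero_of_selmerCorank_eq_zero)
    (hGZK : rank_eq_analyticRank_of_analyticRank_le_one) (p q : ℕ) [Fact p.Prime] [Fact q.Prime] :
    haveI := KubertTate916EisensteinTwist.isElliptic_model
    (⟨((1 : ℤ) : ℚ), ((389 : ℤ) : ℚ), ((-12 : ℤ) : ℚ), ((-74139 : ℤ) : ℚ), ((-35685119 : ℤ) : ℚ)⟩ : WeierstrassCurve ℚ).shaCorank p = 0 →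
      (⟨((1 : ℤ) : ℚ), ((389 : ℤ) : ℚ), ((-12 : ℤ) : ℚ), ((-74139 : ℤ) : ℚ), ((-35685119 : ℤ) : ℚ)⟩ : WeierstrassCurve ℚ).shaCorank q = 0 := by
  haveI := KubertTate916EisensteinTwist.isElliptic_model
  intro _
  haveI := (analyticRank_W₃_eq_zero_and_finite_sha_of_thmE h0 hGZK).2.2
  exact (finite_primaryComponent_sha_iff_shaCorank_eq_zero _ q).1 inferInstance

end Summit.BirchSwinnertonDyer.BirchSwinnertonDyer.Theorems.ShaPrimaryTransferEisensteinTwistDoor916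

end
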